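import Summits.CriticalPhenomena.PercolationContinuityZ3.Theses.PercNearOneGluing
import Summits.CriticalPhenomena.PercolationContinuityZ3.Theorems.PercNearOneGluingAdditiveGluingVariants1360
import HarnessLib

/-!
# Crux `PercNearOneGluing.AdditiveGluing` (stmt-CriticalPhenomena-4576), line `ratio-star` — TYPED ATTACK PLAN for `stub_ratioEdgeMono`
(control-strategist seat, gen 2; companion of `Lines/ratio_star.lean` and `Lines/ratio-star.md` §Attack plan).  Workfile: statements are
`sorry`ed targets for stub-workers (`--supports stmt-CriticalPhenomena-4576`); nothing here is registered.

All on ONE weighting `u` (= `w₀`, the pair `s(o,y)` closed), observer `o ∉ A`, bystander `y`, relays `A ∋ b`, designated `a₀`.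
Events: `WIN = {o↔b} ∩ {a₀↮o}` (o wins), `LOSE = {a₀↔b} ∩ {a₀↮o}` (a₀ wins), `HIJ = WIN ∩ {a₀↔y}` (the hijack: o wins but a₀ holds y),
`GAIN = {y↔b} ∩ {o↮b} ∩ {o↮a₀}` (= Ω + E₁: after opening `s(o,y)`, `o` reaches `b` newly and `a₀` does not ride along),
`DEADGAIN = (⋃_{a∈A} {o↔a})ᶜ ∩ {y↔b}` (= Ω), `Z_{a₀} = (⋃_{a∈A} {o↔a})ᶜ ∩ {a₀↔b}` (designated-selection pocket mass, `stub_goodStep_var1360`),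
`LF = (⋃_{a∈A}{o↔a}) ∩ {o↮b} ∩ {o↮a₀} ∩ {a₀↔b}` (live-fail), `E₁ = (⋃_{a∈A}{o↔a}) ∩ {o↮b} ∩ {o↮a₀} ∩ {y↔b}`,
`Z = Σ_{W∋o dead} μ(C(o)=W)·inf'_A μ(a↔b in Wᶜ)` (worst selection), `K = μ(o↔b) + Z − μ(a₀↔b)`.

* `plan_n12` (PROVABLE NOW): `μ(GAIN)·μ(WIN) ≥ μ(HIJ)·μ(LOSE)` — it is `ratioOneRelay_winner_attracts` (Cruxes/AdditiveGluing/RatioOneRelay.lean,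
  sorry-free, a := a₀, s := o, v := y) followed by the inclusion `{a₀↮o} ∩ {a₀↔b} ∩ {a₀↔y} ⊆ GAIN`.  Meaning: the relative gain
  `Δgain = μ(GAIN) − μ(HIJ)` of a bad observer is `≥ μ(HIJ)·D/μ(WIN) ≥ 0`.
* `plan_n1` (TRUE numerically, 0 violations incl. ~1 900 adversarial climbs; unproved): `μ(DEADGAIN)·μ(WIN) ≥ μ(HIJ)·μ(Z_{a₀})` — a G-type
  inequality for the MIXED functional `1{C(o) dead}·1{a₀↔b}` (antitone in `C(o)`, increasing in `C(a₀)`); candidate tool: `winsDominate` /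
  BHK two-cluster theorem given `a₀↮o`.
* `plan_Y` (TRUE numerically, 0 violations incl. ~2 400 adversarial climbs; unproved; IHV-FREE): `K·n1 + Z·(μ(E₁)μ(WIN) − μ(HIJ)μ(LF)) ≥ 0`.
  With the exact identity `μ(WIN)·M = Z·Y + D·(IHV·μ(WIN) − μ(HIJ)·RO)` (M = the RM⋆ margin `D₀Z₁ − D₁Z₀`, `RO = μ(Z_{a₀}) − Z`,
  `IHV = Σ_{W dead, y∉W} μ(C(o)=W)·K_{u−W}(y) ≥ 0` by the stub's outer hypothesis) Y carries RM⋆ wherever `IHV·μ(WIN) ≥ μ(HIJ)·RO` — off a thin set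
  (that inequality is false by ≤ 1e-8 in exact witnesses), so Y is a lemma candidate, not a proof.
* `plan_peel`, `plan_goodStaysGoodBlock` (second section): the NORMAL FORM of the line in block language — see that section's docstring.
* NOT typed here (see the card): the un-gluing identity `M = K·Ω + Z·E₁ − Z·μ(HIJ) + D·IHV` (bookkeeping from `blockGrowth_glue_real_*`,
  `goodStep_real_update_one`, Lemma Ω `pocket_exchange`) and the coupled remainder `D·(μ(HIJ)·π − (μ(E₁) + IHV)·μ(WIN)) ≤ K·n12`, `π = μ(LF) + RO`,
  which is where the outer induction hypothesis must be spent (dropping IHV is false by 16 %, exact witnesses in the seat's lab/climbA*.out).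
[cite: VandenbergHaggstromKahn2005, Thm. 1.3 (p. 6), Thm. 1.4 (p. 7); KozmaNitzan2024, Lemma 1 (pp. 5–6), §3.2 pp. 12–14, §5.3 p. 34, Question 9 p. 36]
-/

namespace Summit.CriticalPhenomena.PercolationContinuityZ3.Cruxes.AdditiveGluing.RatioStar.Plan

open MeasureTheory Set
open Literature.Probability.LatticeModels (prodBernoulli)
open Literature.Probability.Percolation (BondConfig openConn openConnIn openGraph openCluster)
open scoped BigOperators Classical

noncomputable section

variable {n : ℕ}

/-- **n12 — the relative gain of a bad observer is nonnegative (quantitative form).**  PROVABLE NOW: `ratioOneRelay_winner_attracts u a₀ o y b`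
gives `μ(LOSE)·μ(HIJ) ≤ μ(WIN)·μ({a₀↮o} ∩ {a₀↔b} ∩ {a₀↔y})` and the last event is contained in `GAIN`. -/
theorem plan_n12 (u : Sym2 (Fin n) → unitInterval) (o y b a₀ : Fin n) (ha : a₀ ≠ o) :
    (prodBernoulli u).real (openConn o b ∩ (openConn a₀ o)ᶜ ∩ openConn a₀ y)
        * (prodBernoulli u).real ((openConn a₀ o)ᶜ ∩ openConn a₀ b)
      ≤ (prodBernoulli u).real (openConn y b ∩ (openConn o b)ᶜ ∩ (openConn a₀ o)ᶜ)
        * (prodBernoulli u).real (openConn o b ∩ (openConn a₀ o)ᶜ) := by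
  sorry

/-- **n1 — dead gain × wins ≥ hijack × designated pocket mass** (0 violations; unproved).  `DEADGAIN = (o ↮ A) ∩ {y↔b}`,
`Z_{a₀} = (o ↮ A) ∩ {a₀↔b}` (= `Σ_{W dead} μ(C(o)=W)·μ(a₀↔b in Wᶜ)`, `stub_goodStep_var1360`). -/
theorem plan_n1 (u : Sym2 (Fin n) → unitInterval) (A : Finset (Fin n)) (o y b a₀ : Fin n)
    (hb : b ∈ A) (ho : o ∉ A) (hy : y ∉ A) (hyo : y ≠ o) (ha₀ : a₀ ∈ A)
    (hmin : ∀ a ∈ A, (prodBernoulli u).real (openConnIn (({o} : Set (Fin n))ᶜ) a₀ b)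
      ≤ (prodBernoulli u).real (openConnIn (({o} : Set (Fin n))ᶜ) a b))
    (hbad : (prodBernoulli u).real (openConn o b) < (prodBernoulli u).real (openConn a₀ b)) :
    (prodBernoulli u).real (openConn o b ∩ (openConn a₀ o)ᶜ ∩ openConn a₀ y)
        * (prodBernoulli u).real ((⋃ a ∈ A, openConn o a)ᶜ ∩ openConn a₀ b)
      ≤ (prodBernoulli u).real ((⋃ a ∈ A, openConn o a)ᶜ ∩ openConn y b)
        * (prodBernoulli u).real (openConn o b ∩ (openConn a₀ o)ᶜ) := by
  sorry

/-- **Y — the IHV-free side inequality** (0 violations; unproved): `K·n1 + Z·(μ(E₁)·μ(WIN) − μ(HIJ)·μ(LF)) ≥ 0`, written with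
`K = μ(o↔b) + Z − μ(a₀↔b)`, `Z` the worst-selection pocket sum, `E₁ / LF` the live-other events with `y↔b` / `a₀↔b`. -/
theorem plan_Y (u : Sym2 (Fin n) → unitInterval) (A : Finset (Fin n)) (o y b a₀ : Fin n)
    (hb : b ∈ A) (ho : o ∉ A) (hy : y ∉ A) (hyo : y ≠ o) (ha₀ : a₀ ∈ A)
    (hmin : ∀ a ∈ A, (prodBernoulli u).real (openConnIn (({o} : Set (Fin n))ᶜ) a₀ b)
      ≤ (prodBernoulli u).real (openConnIn (({o} : Set (Fin n))ᶜ) a b))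
    (hbad : (prodBernoulli u).real (openConn o b) < (prodBernoulli u).real (openConn a₀ b))
    (hgood : (prodBernoulli u).real (openConn a₀ b) - (prodBernoulli u).real (openConn o b)
      ≤ ∑ W ∈ (Finset.univ : Finset (Finset (Fin n))).filter (fun W => o ∈ W ∧ Disjoint W A),
          (prodBernoulli u).real {ω : BondConfig (Fin n) | openCluster ω o = (W : Set (Fin n))}
            * A.inf' ⟨b, hb⟩ (fun a => (prodBernoulli u).real (openConnIn ((W : Set (Fin n))ᶜ) a b))) :
    0 ≤ ((prodBernoulli u).real (openConn o b)
          + (∑ W ∈ (Finset.univ : Finset (Finset (Fin n))).filter (fun W => o ∈ W ∧ Disjoint W A),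
              (prodBernoulli u).real {ω : BondConfig (Fin n) | openCluster ω o = (W : Set (Fin n))}
                * A.inf' ⟨b, hb⟩ (fun a => (prodBernoulli u).real (openConnIn ((W : Set (Fin n))ᶜ) a b)))
          - (prodBernoulli u).real (openConn a₀ b))
        * ((prodBernoulli u).real ((⋃ a ∈ A, openConn o a)ᶜ ∩ openConn y b)
              * (prodBernoulli u).real (openConn o b ∩ (openConn a₀ o)ᶜ)
            - (prodBernoulli u).real (openConn o b ∩ (openConn a₀ o)ᶜ ∩ openConn a₀ y)
              * (prodBernoulli u).real ((⋃ a ∈ A, openConn o a)ᶜ ∩ openConn a₀ b))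
      + (∑ W ∈ (Finset.univ : Finset (Finset (Fin n))).filter (fun W => o ∈ W ∧ Disjoint W A),
            (prodBernoulli u).real {ω : BondConfig (Fin n) | openCluster ω o = (W : Set (Fin n))}
              * A.inf' ⟨b, hb⟩ (fun a => (prodBernoulli u).real (openConnIn ((W : Set (Fin n))ᶜ) a b)))
        * ((prodBernoulli u).real ((⋃ a ∈ A, openConn o a) ∩ (openConn o b)ᶜ ∩ (openConn a₀ o)ᶜ ∩ openConn y b)
              * (prodBernoulli u).real (openConn o b ∩ (openConn a₀ o)ᶜ)
            - (prodBernoulli u).real (openConn o b ∩ (openConn a₀ o)ᶜ ∩ openConn a₀ y)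
              * (prodBernoulli u).real ((⋃ a ∈ A, openConn o a) ∩ (openConn o b)ᶜ ∩ (openConn a₀ o)ᶜ ∩ openConn a₀ b)) := by
  sorry


/-! ## Normal form of the line: PEEL (block language, ONE graph `u`, the plain minimiser `a₀ ∈ argmin_A τ_u`)

For a block `T ⊆ V ∖ A` (glued and observed from outside; `K_T = ⋃_{v∈T} C(v)`):
`Z_T = Σ_{W ∩ A = ∅} μ(K_T = W)·inf'_A μ(a ↔ b in Wᶜ)`, `D_T = μ(a₀↔b) + μ(a₀↮b, a₀↔T, T↔b) − μ(T↔b)` (glued deficit),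
`K_T = Z_T − D_T` (block goodness slack = the residual kernel's slack).  `stub_ratioEdgeMono` restricted to SURE prefix stars
(`u = w ∖ o`, `T` = the sure star) is exactly `plan_peel`; at `T = {s}` it is the registered `stub_ratioMonotonePair` of line
`pocket-deficit-ratio` verbatim.  PEEL + `plan_goodStaysGoodBlock` (+ Lemma 5 for `x ∈ A`) give `K_T ≥ 0` for every block from POINT
goodness by induction on `|T|` (a block with `Z_T = 0` and `K_T ≥ 0` has `D_T ≤ 0`, so the chain composes through it), i.e. they discharge
`hres` of the landed `goodStep_of_residualKernelIH`.  Numerics (this seat): PEEL 0 violations for `|T| = 1, 2, 3` (3 107 / 1 207 / 394 random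
instances n ≤ 8, plus g0's 60.9·10⁶ exhaustive pairs at `|T| = 1` and 410 784 at `|T| = 2`); block goodStaysGood 0 / 17 896; block relay
attachment 0 / 28 806.  The general-weight `stub_ratioEdgeMono` is the Ahlswede–Daykin hull of these: it follows by Mathlib's
`four_functions_theorem` from the lattice inequality `Z_{B∪x}·K_{B'} ≤ K_{B∪B'∪x}·Z_{B∩B'}` over sure stars (0 / 96 136; its diagonal is PEEL,
its `B' = ∅` edge is block goodness; the other three assignments of the four functions are false). -/

/-- **PEEL — ratio monotonicity one vertex at a time, block form** (0 violations; = `stub_ratioMonotonePair` when `T = {s}`):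
`D_T > 0`, `x ∉ A`, `x ∉ T` ⟹ `D_{T∪{x}} · Z_T ≤ D_T · Z_{T∪{x}}`. -/
theorem plan_peel (u : Sym2 (Fin n) → unitInterval) (A T : Finset (Fin n)) (b a₀ x : Fin n) (hb : b ∈ A)
    (hTA : Disjoint T A) (hT : T.Nonempty) (hx : x ∉ A) (hxT : x ∉ T) (ha₀ : a₀ ∈ A)
    (hmin : ∀ a ∈ A, (prodBernoulli u).real (openConn a₀ b) ≤ (prodBernoulli u).real (openConn a b))
    (hbad : (prodBernoulli u).real (⋃ v ∈ T, openConn v b)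
      < (prodBernoulli u).real (openConn a₀ b)
        + (prodBernoulli u).real ((openConn a₀ b)ᶜ ∩ (⋃ v ∈ T, openConn a₀ v) ∩ (⋃ v ∈ T, openConn v b))) :
    ((prodBernoulli u).real (openConn a₀ b)
        + (prodBernoulli u).real
            ((openConn a₀ b)ᶜ ∩ (⋃ v ∈ insert x T, openConn a₀ v) ∩ (⋃ v ∈ insert x T, openConn v b))
        - (prodBernoulli u).real (⋃ v ∈ insert x T, openConn v b))
      * (∑ W ∈ (Finset.univ : Finset (Finset (Fin n))).filter (fun W => Disjoint W A),
          (prodBernoulli u).real {ω : BondConfig (Fin n) | ∀ z : Fin n, (z ∈ W ↔ ω ∈ ⋃ v ∈ T, openConn v z)}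
            * A.inf' ⟨b, hb⟩ (fun a => (prodBernoulli u).real (openConnIn ((W : Set (Fin n))ᶜ) a b)))
    ≤ ((prodBernoulli u).real (openConn a₀ b)
        + (prodBernoulli u).real ((openConn a₀ b)ᶜ ∩ (⋃ v ∈ T, openConn a₀ v) ∩ (⋃ v ∈ T, openConn v b))
        - (prodBernoulli u).real (⋃ v ∈ T, openConn v b))
      * (∑ W ∈ (Finset.univ : Finset (Finset (Fin n))).filter (fun W => Disjoint W A),
          (prodBernoulli u).real {ω : BondConfig (Fin n) | ∀ z : Fin n, (z ∈ W ↔ ω ∈ ⋃ v ∈ insert x T, openConn v z)}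
            * A.inf' ⟨b, hb⟩ (fun a => (prodBernoulli u).real (openConnIn ((W : Set (Fin n))ᶜ) a b))) := by
  sorry

/-- **Good blocks stay good** (0 violations; two BHK steps as for `stub_goodStaysGood`): `D_T ≤ 0 ⟹ D_{T∪{x}} ≤ 0` for any vertex `x`
and any `a₀` (no minimiser hypothesis needed). -/
theorem plan_goodStaysGoodBlock (u : Sym2 (Fin n) → unitInterval) (T : Finset (Fin n)) (b a₀ x : Fin n) (ha₀ : a₀ ∉ T)
    (hgood : (prodBernoulli u).real (openConn a₀ b)
        + (prodBernoulli u).real ((openConn a₀ b)ᶜ ∩ (⋃ v ∈ T, openConn a₀ v) ∩ (⋃ v ∈ T, openConn v b))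
      ≤ (prodBernoulli u).real (⋃ v ∈ T, openConn v b)) :
    (prodBernoulli u).real (openConn a₀ b)
        + (prodBernoulli u).real
            ((openConn a₀ b)ᶜ ∩ (⋃ v ∈ insert x T, openConn a₀ v) ∩ (⋃ v ∈ insert x T, openConn v b))
      ≤ (prodBernoulli u).real (⋃ v ∈ insert x T, openConn v b) := by
  sorry

end

end Summit.CriticalPhenomena.PercolationContinuityZ3.Cruxes.AdditiveGluing.RatioStar.Plan
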